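import Summits.ResolutionOfSingularities.ResolutionOfSingularities.Theses.RisoStrata

/-!
# Disproof of `RtdLocal` (crux stmt-ResolutionOfSingularities-18840, route RisoStrata) — findings

Standing adversary file of the crux disprover (cdisprove).  Index:

* **Verdict so far: NO KILL — the crux is (very likely) TRUE as typed.**  Four independent refuter
  passes (rreview, g78-7, rattack `Attack.md` §8, this seat) reach the same elementary proof:
  arcs of `B` at `m = m' ∩ B` and of `B' = B[s⁻¹]` at `m'` biject (`a(s) ∈ c + 𝔪`, `c ≠ 0`, is a
  unit of `k⟦t^ℚ⟧`); typed clause (1) `∃ j ∀ i` is the max-norm rv condition (take `j = argmin`);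
  UP move `g' := (g, s⁻¹ - c⁻¹)`, `φ' := (φ, λ ∘ φ)`, `W' := graph λ|_W` (λ = linear part of
  `s⁻¹ - c⁻¹` in the coordinates `g`; error terms have order `> v(a g - b g)` by the ultrametric
  Taylor estimate `v(P x - P y - dP₀(x - y)) > v(x - y)` on `𝔪ⁿ` and `v(a s) = v(b s) = 0`);
  DOWN move: extend a straightener of `B'` for `g'` to the presentation `(g', g)` (`g = Q(g')`,
  graph move again), then project to the `g`-block (`v(a g - b g) = v(a g' - b g')` because the two
  tuples are mutually Lipschitz on centred arcs; every `u ∈ W'' ∖ 0` is a leading difference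
  direction, hence of the form `(d', d)` with `d ≠ 0`, so the projection is injective on `W''`).
  No counterexample can exist if this sketch is right; the line picked by the lead (PICKED.md:
  pad / collapse / gl / sq_dominated / arcEquiv / cotangent_span / invariance) is one rendering of it.
* **(a) Load-bearing hypotheses** (any proof must use them):
  - `hs : s ∈ B` — `rtdLocal_false_without_mem` (PROVED here, 0 sorry; LANDED as
    `Theorems/RtdLocal/Negative/RtdLocalFalseWithoutMem.lean`, p144813 accepted @5ed8a59b9b7c): `B = ⊥ ⊆ k(X)`,
    `s = X⁻¹`, `r = 1` — `B' = k[X]` has typed rtd `≥ 1` at the origin, `⊥` has one arc only.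
  - `B.FG` — `rtdLocal_false_without_FG` (PROVED here, 0 sorry; LANDED as
    `Theorems/RtdLocal/Negative/RtdLocalFalseWithoutFG.lean`, p145103 accepted @ca1d372e1eca): `B = k + x·k[x,y] =
    k[x, xy, xy², …] ⊆ k(x,y)` (not f.g.: generators of `y`-degree `≤ N` miss `x·y^{N+1}`),
    `s = x`, `r = 0`: `B' = k[x, x⁻¹, y]` is f.g., so `Rtd B' m' 0` holds at EVERY maximal `m'`
    (Nullstellensatz shift of the generators into `m'`, identity straightener, `W = 0`), while
    `Rtd B m 0` needs a FINITE presentation of `B`.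
* **Not load-bearing** (statement stays TRUE when dropped, so no `_false_without_` theorem exists;
  information for the prover): `IsAlgClosed k` and `CharP k p` (if `B/m ≠ k` both sides are false
  for every `r` — no presentation inside `m` — and `B/m ≅ B'/m'` always); `s ≠ 0` (`s = 0` gives
  `s⁻¹ = 0`, `B' = B`); `m'.IsMaximal` beyond `m' ≠ ⊤` (a presentation inside a proper `m'` forces
  `B' = k + m'`, i.e. `m'` maximal with residue field `k`, and then `m' ∩ B` is maximal too; for
  `m' = ⊤` both arc spaces are empty and both sides hold).
* **(b)/(c) Boundary facts about the typed `Rtd`** used above and reusable by the line: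
  `rtd_bot_succ_false` — `Rtd ⊥ m (r+1)` is false for every proper ideal `m` of `⊥ = k`
  (one arc; clause (3) fails for `w = t·u`); together with `RtdAffineLine` (tree) this is the
  dimension gap the `s ∈ B` witness exploits.
* **Targets**: none yet (payload.targets / stuck_stubs empty at arming).  When the lead reports
  STUCK stubs of line `Sketch`, their kills go in § Targets below.
* **Near-misses**: none — nothing false was found in the crux itself.
-/

set_option linter.dupNamespace false

namespace Summit.ResolutionOfSingularities.ResolutionOfSingularities.Cruxes.RtdLocal.Disproof

section Mem

open Polynomial

section Helpers

variable {k : Type} [Field k]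

/-- (copy of the landed `rtdAffineLine_orderTop_aeval_nonneg`, kept private so that this work file
elaborates from the route file alone) -/
private theorem orderTop_aeval_nonneg' {u : HahnSeries ℚ k} (hu : 0 ≤ u.orderTop)
    (f : k[X]) : 0 ≤ (aeval u f).orderTop := by
  induction f using Polynomial.induction_on' with
  | add p q hp hq =>
    rw [map_add]
    exact (le_min hp hq).trans HahnSeries.min_orderTop_le_orderTop_add
  | monomial n c =>
    rw [aeval_monomial]
    refine (add_nonneg ?_ ?_).trans HahnSeries.orderTop_add_le_mul
    · have hC : algebraMap k (HahnSeries ℚ k) c = HahnSeries.C c := by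
        first
        | rfl
        | (rw [HahnSeries.algebraMap_apply']; simp)
      rw [hC, HahnSeries.C_apply]
      exact HahnSeries.orderTop_single_le
    · exact (nsmul_nonneg hu n).trans HahnSeries.orderTop_nsmul_le_orderTop_pow

/-- (copy of the landed `rtdAffineLine_orderTop_aeval_pos`) -/
private theorem orderTop_aeval_pos' {u : HahnSeries ℚ k} (hu : 0 < u.orderTop) {f : k[X]}
    (hf : f.coeff 0 = 0) : 0 < (aeval u f).orderTop := by
  have h := X_mul_divX_add f
  rw [hf, map_zero, add_zero] at h
  rw [← h, map_mul, aeval_X, HahnSeries.orderTop_mul]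
  exact add_pos_of_pos_of_nonneg hu (orderTop_aeval_nonneg' hu.le _)


variable {A' : Type} [Semiring A'] [Algebra k A'] (E : k[X] ≃ₐ[k] A')

/-- Two `k`-algebra maps out of a copy `A' ≅ k[X]` of the polynomial ring that agree at the
variable are equal. [folklore] -/
theorem rtdLocalNeg_algHom_eq {A : Type} [Semiring A] [Algebra k A] {α β : A' →ₐ[k] A}
    (h : α (E X) = β (E X)) : α = β := by
  have hX : (α.comp (E : k[X] →ₐ[k] A')) X = (β.comp (E : k[X] →ₐ[k] A')) X := h
  have hcomp := Polynomial.algHom_ext hX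
  ext x
  obtain ⟨f, rfl⟩ := E.surjective x
  exact DFunLike.congr_fun hcomp f

/-- A `k`-algebra map `ψ` out of `A' ≅ k[X]` sending the variable to a Hahn series of positive
order sends (the image of) every polynomial without constant term to positive order. [folklore] -/
theorem rtdLocalNeg_orderTop_pos_of_coeff (ψ : A' →ₐ[k] HahnSeries ℚ k)
    (hψ : 0 < (ψ (E X)).orderTop) {f : k[X]} (hf : f.coeff 0 = 0) :
    0 < (ψ (E f)).orderTop := by
  have key : ψ (E f) = aeval (ψ (E X)) f := by
    change (ψ.comp (E : k[X] →ₐ[k] A')) f = aeval ((ψ.comp (E : k[X] →ₐ[k] A')) X) f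
    rw [aeval_algHom_apply, aeval_X_left_apply]
  rw [key]
  exact orderTop_aeval_pos' hψ hf

variable {K : Type} [Field K] [Algebra k K]

/-- `k`-algebra maps out of `⊥ = k ⊆ K` form a subsingleton (inside any subtype). [folklore] -/
theorem rtdLocalNeg_arc_bot_subsingleton {A : Type} [Semiring A] [Algebra k A]
    (P : (↥(⊥ : Subalgebra k K) →ₐ[k] A) → Prop) (a b : {α // P α}) : a = b := by
  refine Subtype.ext (AlgHom.ext fun x => ?_)
  obtain ⟨c, hc⟩ := Algebra.mem_bot.mp x.2
  have hx : x = algebraMap k _ c := Subtype.ext hc.symm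
  rw [hx, AlgHom.commutes, AlgHom.commutes]

/-- Elements of a proper ideal of `⊥ = k ⊆ K` are zero, so any map sends them to order `⊤ > 0`.
[folklore] -/
theorem rtdLocalNeg_orderTop_pos_of_mem_bot (α : ↥(⊥ : Subalgebra k K) →ₐ[k] HahnSeries ℚ k)
    (J : Ideal ↥(⊥ : Subalgebra k K)) (hJ : J ≠ ⊤) (x : ↥(⊥ : Subalgebra k K)) (hx : x ∈ J) :
    0 < (α x).orderTop := by
  obtain ⟨c, hc⟩ := Algebra.mem_bot.mp x.2
  have hxc : x = algebraMap k _ c := Subtype.ext hc.symm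
  by_cases hc0 : c = 0
  · rw [hxc, hc0, map_zero, map_zero, HahnSeries.orderTop_zero]
    exact WithTop.top_pos
  · exact absurd (J.eq_top_of_isUnit_mem hx (hxc ▸ (Ne.isUnit hc0).map _)) hJ

end Helpers

/-- **`s ∈ B` is load-bearing in `RtdLocal`** (inline form, identical to the landed
`Theorems/RtdLocal/Negative/RtdLocalFalseWithoutMem.lean`): the crux with `hs : s ∈ B` deleted is
false.  Witness `p = 2`, `k = 𝔽₂^alg`, `K = k(X)`, `B = ⊥`, `s = X⁻¹`, `m' =` origin, `r = 1`.
[folklore] -/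
theorem rtdLocal_false_without_mem_inline : ¬ (∀ p : ℕ, p.Prime → ∀ (k : Type) [Field k] [CharP k p] [IsAlgClosed k] (K : Type) [Field K] [Algebra k K] (B : Subalgebra k K) (s : K), s ≠ 0 → B.FG → let Arc : ∀ (B : Subalgebra k K), Ideal ↥B → Type := fun B m => {α : ↥B →ₐ[k] HahnSeries ℚ k // ∀ b ∈ m, 0 < (α b).orderTop}; let Rtd : ∀ (B : Subalgebra k K), Ideal ↥B → ℕ → Prop := fun B m r => ∃ (n : ℕ) (g : Fin n → ↥B), (∀ i, g i ∈ m) ∧ Algebra.adjoin k (Set.range fun i => (g i : K)) = B ∧ ∃ W : Submodule k (Fin n → k), r ≤ Module.finrank k ↥W ∧ ∃ φ : Arc B m → (Fin n → HahnSeries ℚ k), (∀ a b : Arc B m, a ≠ b → ∃ j, ∀ i, (a.1 (g j) - b.1 (g j)).orderTop < ((φ a i - φ b i) - (a.1 (g i) - b.1 (g i))).orderTop) ∧ (∀ a i, 0 < (φ a i).orderTop) ∧ (∀ a, ∀ w : Fin n → HahnSeries ℚ k, (∀ i, 0 < (w i).orderTop) → w ∈ Submodule.span (HahnSeries ℚ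 k) ((fun u : Fin n → k => fun i => HahnSeries.C (u i)) '' (W : Set (Fin n → k))) → ∃ b, φ b = φ a + w); ∀ (m' : Ideal ↥(Algebra.adjoin k ((B : Set K) ∪ {s⁻¹}))), m'.IsMaximal → ∀ r : ℕ, (Rtd (Algebra.adjoin k ((B : Set K) ∪ {s⁻¹})) m' r ↔ Rtd B (m'.comap (Subalgebra.inclusion (show B ≤ Algebra.adjoin k ((B : Set K) ∪ {s⁻¹}) from fun _ hb => Algebra.subset_adjoin (Set.mem_union_left _ hb)))) r)) := by
  intro H
  obtain ⟨k, _i1, _i2, _i3, K, _i4, _i5, t, ht⟩ : ∃ (k : Type) (_ : Field k) (_ : CharP k 2)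
      (_ : IsAlgClosed k) (K : Type) (_ : Field K) (_ : Algebra k K) (t : K), Transcendental k t :=
    ⟨AlgebraicClosure (ZMod 2), inferInstance, inferInstance, inferInstance,
      RatFunc (AlgebraicClosure (ZMod 2)), inferInstance, inferInstance, RatFunc.X,
      RatFunc.transcendental_X⟩
  have ht0 : t ≠ 0 := fun h => ht (h ▸ isAlgebraic_zero)
  have H' := H 2 Nat.prime_two k K ⊥ t⁻¹ (inv_ne_zero ht0) Subalgebra.fg_bot
  clear H
  dsimp only at H'
  -- `B' := k[↑⊥ ∪ {t⁻¹⁻¹}] = k[t] ≅ k[X]`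
  have e : Algebra.adjoin k ({t} : Set K) =
      Algebra.adjoin k (((⊥ : Subalgebra k K) : Set K) ∪ {t⁻¹⁻¹}) := by
    rw [inv_inv]
    apply le_antisymm
    · exact Algebra.adjoin_mono Set.subset_union_right
    · refine Algebra.adjoin_le ?_
      rintro z (hz | hz)
      · exact (bot_le : (⊥ : Subalgebra k K) ≤ Algebra.adjoin k {t}) hz
      · exact Algebra.subset_adjoin hz
  let E : k[X] ≃ₐ[k] ↥(Algebra.adjoin k (((⊥ : Subalgebra k K) : Set K) ∪ {t⁻¹⁻¹})) :=
    (algEquivOfTranscendental k t ht).trans (Subalgebra.equivOfEq _ _ e)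
  have hEX : ((E X : ↥(Algebra.adjoin k (((⊥ : Subalgebra k K) : Set K) ∪ {t⁻¹⁻¹}))) : K) = t := by
    change (((Subalgebra.equivOfEq _ _ e) (algEquivOfTranscendental k t ht X)) : K) = t
    rw [algEquivOfTranscendental_apply_X]
    rfl
  -- the origin `m' = ker ev₀`
  let ev₀ : ↥(Algebra.adjoin k (((⊥ : Subalgebra k K) : Set K) ∪ {t⁻¹⁻¹})) →ₐ[k] k :=
    (aeval (0 : k)).comp (E.symm : _ →ₐ[k] k[X])
  have hev₀ : ∀ f : k[X], ev₀ (E f) = f.coeff 0 := by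
    intro f
    change aeval (0 : k) (E.symm (E f)) = f.coeff 0
    rw [AlgEquiv.symm_apply_apply, coeff_zero_eq_aeval_zero]
  have hm' : (RingHom.ker ev₀).IsMaximal :=
    RingHom.ker_isMaximal_of_surjective ev₀ fun c => ⟨algebraMap k _ c, AlgHom.commutes ev₀ c⟩
  have htm' : E X ∈ RingHom.ker ev₀ := by
    rw [RingHom.mem_ker, ← coeff_X_zero (R := k)]
    exact hev₀ X
  have hpos : ∀ (ψ : ↥(Algebra.adjoin k (((⊥ : Subalgebra k K) : Set K) ∪ {t⁻¹⁻¹})) →ₐ[k]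
      HahnSeries ℚ k), 0 < (ψ (E X)).orderTop → ∀ b ∈ RingHom.ker ev₀, 0 < (ψ b).orderTop := by
    intro ψ hψ b hb
    obtain ⟨f, rfl⟩ := E.surjective b
    have hf : f.coeff 0 = 0 := by rw [← hev₀]; exact RingHom.mem_ker.mp hb
    exact rtdLocalNeg_orderTop_pos_of_coeff E ψ hψ hf
  -- LHS true ⇒ RHS true
  obtain ⟨n, g, -, -, W, hW, φ, -, -, h3⟩ := (H' (RingHom.ker ev₀) hm' 1).mp (by
    refine ⟨1, fun _ => E X, fun _ => htm', ?_, ⊤, ?_, fun a _ => a.1 (E X), ?_,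
      fun a _ => a.2 _ htm', ?_⟩
    · -- the single generator `t` generates `k[↑⊥ ∪ {t⁻¹⁻¹}] = k[t]`
      simp only [hEX, Set.range_const]
      exact e
    · -- `finrank k k¹ = 1`
      rw [finrank_top, Module.finrank_fin_fun]
    · -- rv-separation: distinct arcs differ at the variable, the straightened difference vanishes
      intro a b hab
      refine ⟨0, fun i => ?_⟩
      rw [sub_self, HahnSeries.orderTop_zero, WithTop.lt_top_iff_ne_top, Ne,
        HahnSeries.orderTop_eq_top, sub_eq_zero]
      exact fun h => hab (Subtype.ext (rtdLocalNeg_algHom_eq E h))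
    · -- translation by any `w` of positive order: the arc `X ↦ a X + w 0`
      intro a w hw _
      have hu : 0 < (a.1 (E X) + w 0).orderTop :=
        (lt_min (a.2 _ htm') (hw 0)).trans_le HahnSeries.min_orderTop_le_orderTop_add
      have hψt : ((aeval (a.1 (E X) + w 0)).comp (E.symm : _ →ₐ[k] k[X])) (E X) =
          a.1 (E X) + w 0 := by
        change aeval _ (E.symm (E X)) = _
        rw [AlgEquiv.symm_apply_apply, aeval_X]
      refine ⟨⟨(aeval (a.1 (E X) + w 0)).comp (E.symm : _ →ₐ[k] k[X]), fun b hb =>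
        hpos _ (hψt.symm ▸ hu) b hb⟩, ?_⟩
      funext i
      rw [Pi.add_apply, Subsingleton.elim i 0]
      exact hψt)
  -- RHS: `Rtd ⊥ m 1` is impossible — the arc space of `⊥ = k` is one point
  let α₀ : ↥(⊥ : Subalgebra k K) →ₐ[k] HahnSeries ℚ k :=
    (Algebra.ofId k (HahnSeries ℚ k)).comp (Algebra.botEquiv k K : _ →ₐ[k] k)
  obtain ⟨u, hu0⟩ :=
    Module.finrank_pos_iff_exists_ne_zero.mp (by omega : 0 < Module.finrank k ↥W)
  obtain ⟨b, hb⟩ := h3 ⟨α₀, rtdLocalNeg_orderTop_pos_of_mem_bot α₀ _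
      (Ideal.comap_ne_top _ hm'.ne_top)⟩
    (fun i => HahnSeries.single (1 : ℚ) ((u : Fin n → k) i))
    (fun i => by
      by_cases hi : (u : Fin n → k) i = 0
      · rw [hi, HahnSeries.single_eq_zero, HahnSeries.orderTop_zero]
        exact WithTop.top_pos
      · rw [HahnSeries.orderTop_single hi]
        exact_mod_cast one_pos)
    (by
      have hw : (fun i => HahnSeries.single (1 : ℚ) ((u : Fin n → k) i)) =
          HahnSeries.single (1 : ℚ) (1 : k) • fun i => HahnSeries.C ((u : Fin n → k) i) := by
        funext i
        rw [Pi.smul_apply, smul_eq_mul, HahnSeries.C_apply, HahnSeries.single_mul_single,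
          add_zero, one_mul]
      rw [hw]
      exact Submodule.smul_mem _ _ (Submodule.subset_span ⟨u, u.2, rfl⟩))
  rw [rtdLocalNeg_arc_bot_subsingleton _ b ⟨α₀, rtdLocalNeg_orderTop_pos_of_mem_bot α₀ _
      (Ideal.comap_ne_top _ hm'.ne_top)⟩] at hb
  have hw0 := left_eq_add.mp hb
  apply hu0
  rw [← Submodule.coe_eq_zero]
  funext i
  exact HahnSeries.single_eq_zero_iff.mp (congr_fun hw0 i)



end Mem

section FG

open MvPolynomial

/-- Polynomials whose exponent vectors all satisfy an additively closed predicate form a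
subalgebra (existence form, to keep this file definition-free). [folklore] -/
theorem rtdLocalNeg_exists_supportSubalgebra {σ : Type} {k : Type} [Field k]
    (p : (σ →₀ ℕ) → Prop) (h0 : p 0) (hadd : ∀ a b, p a → p b → p (a + b)) :
    ∃ S : Subalgebra k (MvPolynomial σ k), ∀ P, P ∈ S ↔ ∀ d ∈ P.support, p d := by
  classical
  have hC : ∀ (c : k), ∀ d ∈ (C c : MvPolynomial σ k).support, p d := by
    intro c d hd
    rw [C_apply, support_monomial] at hd
    split_ifs at hd with hc
    · simp at hd
    · rw [Finset.mem_singleton] at hd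
      rw [hd]
      exact h0
  refine ⟨{ carrier := {P | ∀ d ∈ P.support, p d}
            mul_mem' := ?_, one_mem' := ?_, add_mem' := ?_, zero_mem' := ?_,
            algebraMap_mem' := ?_ }, fun P => Iff.rfl⟩
  · intro P Q hP hQ d hd
    obtain ⟨a, ha, b, hb, rfl⟩ := Finset.mem_add.mp (support_mul P Q hd)
    exact hadd a b (hP a ha) (hQ b hb)
  · intro d hd
    rw [← C_1] at hd
    exact hC 1 d hd
  · intro P Q hP hQ d hd
    rcases Finset.mem_union.mp (Finsupp.support_add hd) with h | h
    exacts [hP d h, hQ d h]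
  · intro d hd
    simp at hd
  · intro c d hd
    rw [MvPolynomial.algebraMap_eq] at hd
    exact hC c d hd

/-- `k + X₀·k[X₀,X₁] ⊆ k[X₀,X₁]` (polynomials `P` with `P(0,X₁)` constant) is NOT a finitely
generated `k`-algebra: generators with `X₁`-degree `≤ N` only produce monomials `X₀ᵃX₁ᵇ` with
`b ≤ N a`, missing `X₀X₁^{N+1}`. [folklore] -/
theorem rtdLocalNeg_not_fg_of_support {k : Type} [Field k] (S' : Subalgebra k (MvPolynomial (Fin 2) k))
    (hS' : ∀ P, P ∈ S' ↔ ∀ d ∈ P.support, d 0 = 0 → d 1 = 0) : ¬ S'.FG := by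
  classical
  rintro ⟨T, hT⟩
  let N : ℕ := T.sup fun t => (t : MvPolynomial (Fin 2) k).degreeOf 1
  obtain ⟨SN, hSN⟩ := rtdLocalNeg_exists_supportSubalgebra (k := k) (σ := Fin 2)
    (fun d => d 1 ≤ N * d 0) (by simp) (fun a b ha hb => by
      simp only [Finsupp.coe_add, Pi.add_apply, mul_add]
      exact add_le_add ha hb)
  have hTS : (T : Set (MvPolynomial (Fin 2) k)) ⊆ SN := fun t ht => (hSN t).mpr fun d hd => by
    by_cases hd0 : d 0 = 0
    · have ht' : t ∈ S' := by rw [← hT]; exact Algebra.subset_adjoin ht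
      rw [(hS' t).mp ht' d hd hd0]
      exact Nat.zero_le _
    · calc d 1 ≤ (t : MvPolynomial (Fin 2) k).degreeOf 1 := monomial_le_degreeOf 1 hd
        _ ≤ N := Finset.le_sup (f := fun t => (t : MvPolynomial (Fin 2) k).degreeOf 1) ht
        _ ≤ N * d 0 := Nat.le_mul_of_pos_right N (Nat.pos_of_ne_zero hd0)
  have hle : S' ≤ SN := by rw [← hT]; exact Algebra.adjoin_le hTS
  have hmon : (X 0 * X 1 ^ (N + 1) : MvPolynomial (Fin 2) k) =
      monomial (Finsupp.single 0 1 + Finsupp.single 1 (N + 1)) 1 := by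
    rw [X_pow_eq_monomial, X, monomial_mul, one_mul]
  have hsupp : (X 0 * X 1 ^ (N + 1) : MvPolynomial (Fin 2) k).support =
      {Finsupp.single 0 1 + Finsupp.single 1 (N + 1)} := by
    rw [hmon, support_monomial, if_neg one_ne_zero]
  have hmem : (X 0 * X 1 ^ (N + 1) : MvPolynomial (Fin 2) k) ∈ S' := by
    refine (hS' _).mpr fun d hd h0 => ?_
    rw [hsupp, Finset.mem_singleton] at hd
    subst hd
    simp at h0
  have hnot : (X 0 * X 1 ^ (N + 1) : MvPolynomial (Fin 2) k) ∉ SN := fun h => by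
    have := (hSN _).mp h (Finsupp.single 0 1 + Finsupp.single 1 (N + 1))
      (by rw [hsupp, Finset.mem_singleton])
    simp at this
  exact hnot (hle hmem)

/-- **`B.FG` is load-bearing in `RtdLocal`**: the crux `RisoStrata.RtdLocal` with the hypothesis
`B.FG` deleted (all other text verbatim) is false.
Witness `p = 2`, `k = 𝔽₂^alg`, `K = k(X₀,X₁)`, `B = k + X₀·k[X₀,X₁]` (not f.g.), `s = X₀`,
`B' = k[B ∪ {X₀⁻¹}] = k[X₀, X₀⁻¹, X₁]`, any maximal `m'`, `r = 0`: `Rtd B' m' 0` holds (shift the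
three generators into `m'` by the Nullstellensatz, identity straightener, `W = 0`), while
`Rtd B m 0` would exhibit a finite presentation of `B`. [folklore] -/
theorem rtdLocal_false_without_FG_inline : ¬ (∀ p : ℕ, p.Prime → ∀ (k : Type) [Field k] [CharP k p] [IsAlgClosed k] (K : Type) [Field K] [Algebra k K] (B : Subalgebra k K) (s : K) (hs : s ∈ B), s ≠ 0 → let Arc : ∀ (B : Subalgebra k K), Ideal ↥B → Type := fun B m => {α : ↥B →ₐ[k] HahnSeries ℚ k // ∀ b ∈ m, 0 < (α b).orderTop}; let Rtd : ∀ (B : Subalgebra k K), Ideal ↥B → ℕ → Prop := fun B m r => ∃ (n : ℕ) (g : Fin n → ↥B), (∀ i, g i ∈ m) ∧ Algebra.adjoin k (Set.range fun i => (g i : K)) = B ∧ ∃ W : Submodule k (Fin n → k), r ≤ Module.finrank k ↥W ∧ ∃ φ : Arc B m → (Fin n → HahnSeries ℚ k), (∀ a b : Arc B m, a ≠ b → ∃ j, ∀ i, (a.1 (g j) - b.1 (g j)).orderTop < ((φ a i - φ b i) - (a.1 (g i) - b.1 (g i))).orderTop) ∧ (∀ a i, 0 < (φ a i).orderTop) ∧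 (∀ a, ∀ w : Fin n → HahnSeries ℚ k, (∀ i, 0 < (w i).orderTop) → w ∈ Submodule.span (HahnSeries ℚ k) ((fun u : Fin n → k => fun i => HahnSeries.C (u i)) '' (W : Set (Fin n → k))) → ∃ b, φ b = φ a + w); ∀ (m' : Ideal ↥(Algebra.adjoin k ((B : Set K) ∪ {s⁻¹}))), m'.IsMaximal → ∀ r : ℕ, (Rtd (Algebra.adjoin k ((B : Set K) ∪ {s⁻¹})) m' r ↔ Rtd B (m'.comap (Subalgebra.inclusion (show B ≤ Algebra.adjoin k ((B : Set K) ∪ {s⁻¹}) from fun _ hb => Algebra.subset_adjoin (Set.mem_union_left _ hb)))) r)) := by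
  intro H
  obtain ⟨k, _i1, _i2, _i3, K, _i4, _i5, ι, hι⟩ : ∃ (k : Type) (_ : Field k) (_ : CharP k 2)
      (_ : IsAlgClosed k) (K : Type) (_ : Field K) (_ : Algebra k K)
      (ι : MvPolynomial (Fin 2) k →ₐ[k] K), Function.Injective ι :=
    ⟨AlgebraicClosure (ZMod 2), inferInstance, inferInstance, inferInstance,
      FractionRing (MvPolynomial (Fin 2) (AlgebraicClosure (ZMod 2))), inferInstance,
      inferInstance, IsScalarTower.toAlgHom _ _ _, IsFractionRing.injective _ _⟩
  classical
  -- `S' = k + X₀·k[X₀,X₁]`, `B = ι(S')`, `s = x := ι X₀`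
  obtain ⟨S', hS'⟩ := rtdLocalNeg_exists_supportSubalgebra (k := k) (σ := Fin 2)
    (fun d => d 0 = 0 → d 1 = 0) (fun _ => rfl) (fun a b ha hb h => by
      simp only [Finsupp.coe_add, Pi.add_apply, Nat.add_eq_zero_iff] at h ⊢
      exact ⟨ha h.1, hb h.2⟩)
  have hmonmem : ∀ n : ℕ, (X 0 * X 1 ^ n : MvPolynomial (Fin 2) k) ∈ S' := by
    intro n
    refine (hS' _).mpr fun d hd h0 => ?_
    rw [X_pow_eq_monomial, X, monomial_mul, one_mul, support_monomial, if_neg one_ne_zero,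
      Finset.mem_singleton] at hd
    subst hd
    simp at h0
  have hX0 : (X 0 : MvPolynomial (Fin 2) k) ∈ S' := by simpa using hmonmem 0
  have hx0 : ι (X 0) ≠ 0 := (map_ne_zero_iff ι hι).mpr (X_ne_zero 0)
  have H' := H 2 Nat.prime_two k K (S'.map ι) (ι (X 0)) (Subalgebra.mem_map.mpr ⟨X 0, hX0, rfl⟩)
    hx0
  clear H
  dsimp only at H'
  -- `B' = k[B ∪ {x⁻¹}] = k[x, x⁻¹, y]`
  have hxB' : ι (X 0) ∈ Algebra.adjoin k (((S'.map ι : Subalgebra k K) : Set K) ∪ {(ι (X 0))⁻¹}) :=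
    Algebra.subset_adjoin (Or.inl (Subalgebra.mem_map.mpr ⟨X 0, hX0, rfl⟩))
  have hxiB' : (ι (X 0))⁻¹ ∈
      Algebra.adjoin k (((S'.map ι : Subalgebra k K) : Set K) ∪ {(ι (X 0))⁻¹}) :=
    Algebra.subset_adjoin (Or.inr rfl)
  have hyB' : ι (X 1) ∈ Algebra.adjoin k (((S'.map ι : Subalgebra k K) : Set K) ∪ {(ι (X 0))⁻¹}) := by
    have h : ι (X 1) = (ι (X 0))⁻¹ * ι (X 0 * X 1 ^ 1) := by
      rw [pow_one, map_mul, ← mul_assoc, inv_mul_cancel₀ hx0, one_mul]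
    rw [h]
    exact mul_mem hxiB'
      (Algebra.subset_adjoin (Or.inl (Subalgebra.mem_map.mpr ⟨_, hmonmem 1, rfl⟩)))
  have hB'eq : Algebra.adjoin k (Set.range ![ι (X 0), (ι (X 0))⁻¹, ι (X 1)]) =
      Algebra.adjoin k (((S'.map ι : Subalgebra k K) : Set K) ∪ {(ι (X 0))⁻¹}) := by
    apply le_antisymm
    · refine Algebra.adjoin_le ?_
      rintro _ ⟨i, rfl⟩
      fin_cases i
      exacts [hxB', hxiB', hyB']
    · refine Algebra.adjoin_le ?_
      rintro z (hz | hz)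
      · obtain ⟨P, -, rfl⟩ := Subalgebra.mem_map.mp hz
        have hP : ι P ∈ (Algebra.adjoin k (Set.range (X : Fin 2 → MvPolynomial (Fin 2) k))).map ι := by
          rw [MvPolynomial.adjoin_range_X]
          exact Subalgebra.mem_map.mpr ⟨P, Algebra.mem_top, rfl⟩
        rw [AlgHom.map_adjoin] at hP
        refine (Algebra.adjoin_mono ?_) hP
        rintro _ ⟨_, ⟨i, rfl⟩, rfl⟩
        fin_cases i
        exacts [⟨0, rfl⟩, ⟨2, rfl⟩]
      · rw [Set.mem_singleton_iff] at hz
        subst hz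
        exact Algebra.subset_adjoin ⟨1, rfl⟩
  -- a maximal ideal `m'` of `B'` and the Nullstellensatz shift of the generators into it
  obtain ⟨m', hm'⟩ := Ideal.exists_maximal
    ↥(Algebra.adjoin k (((S'.map ι : Subalgebra k K) : Set K) ∪ {(ι (X 0))⁻¹}))
  let gens : Fin 3 → ↥(Algebra.adjoin k (((S'.map ι : Subalgebra k K) : Set K) ∪ {(ι (X 0))⁻¹})) :=
    ![⟨ι (X 0), hxB'⟩, ⟨(ι (X 0))⁻¹, hxiB'⟩, ⟨ι (X 1), hyB'⟩]
  have hgensval : (fun i => (gens i : K)) = ![ι (X 0), (ι (X 0))⁻¹, ι (X 1)] := by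
    funext i
    fin_cases i <;> rfl
  let Φ := MvPolynomial.aeval (R := k) gens
  have hΦ : Function.Surjective Φ := by
    rw [← AlgHom.range_eq_top, ← Algebra.adjoin_range_eq_range_aeval]
    apply Subalgebra.map_injective (f := Subalgebra.val _) Subtype.val_injective
    rw [AlgHom.map_adjoin, Algebra.map_top, Subalgebra.range_val, ← Set.range_comp]
    show Algebra.adjoin k (Set.range fun i => (gens i : K)) = _
    rw [hgensval]
    exact hB'eq
  haveI := hm'
  obtain ⟨c, hc⟩ := MvPolynomial.isMaximal_iff_eq_vanishingIdeal_singleton.mp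
    (Ideal.comap_isMaximal_of_surjective Φ hΦ (K := m'))
  let g : Fin 3 → ↥(Algebra.adjoin k (((S'.map ι : Subalgebra k K) : Set K) ∪ {(ι (X 0))⁻¹})) :=
    fun i => gens i - algebraMap k _ (c i)
  have hΦX : ∀ i, Φ (X i) = gens i := fun i => MvPolynomial.aeval_X gens i
  have hg : ∀ i, g i ∈ m' := by
    intro i
    have hi : (X i - C (c i) : MvPolynomial (Fin 3) k) ∈ Ideal.comap Φ m' := by
      rw [hc, MvPolynomial.mem_vanishingIdeal_singleton_iff]
      simp
    rw [Ideal.mem_comap, map_sub, hΦX, MvPolynomial.aeval_C] at hi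
    exact hi
  have hgen : Algebra.adjoin k (Set.range fun i => (g i : K)) =
      Algebra.adjoin k (((S'.map ι : Subalgebra k K) : Set K) ∪ {(ι (X 0))⁻¹}) := by
    apply le_antisymm
    · refine Algebra.adjoin_le ?_
      rintro _ ⟨i, rfl⟩
      exact (g i).2
    · refine le_of_eq_of_le hB'eq.symm (Algebra.adjoin_le ?_)
      rintro _ ⟨i, rfl⟩
      have h : (![ι (X 0), (ι (X 0))⁻¹, ι (X 1)] i : K) = (g i : K) + algebraMap k K (c i) := by
        rw [← congr_fun hgensval i]
        change (gens i : K) = ((gens i - algebraMap k _ (c i) : ↥(Algebra.adjoin k _)) : K) + _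
        rw [Subalgebra.coe_sub, Subalgebra.coe_algebraMap, sub_add_cancel]
      rw [h]
      exact add_mem (Algebra.subset_adjoin ⟨i, rfl⟩) (algebraMap_mem _ _)
  -- LHS `Rtd B' m' 0` holds ⇒ RHS `Rtd B (m' ∩ B) 0` holds
  obtain ⟨n, g₂, -, hgen₂, -⟩ := (H' m' hm' 0).mp (by
    refine ⟨3, g, hg, hgen, ⊥, Nat.zero_le _, fun a i => a.1 (g i), ?_, fun a i => a.2 _ (hg i), ?_⟩
    · intro a b hab
      by_cases hex : ∃ j, a.1 (g j) ≠ b.1 (g j)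
      · obtain ⟨j, hj⟩ := hex
        refine ⟨j, fun i => ?_⟩
        rw [sub_self, HahnSeries.orderTop_zero, WithTop.lt_top_iff_ne_top, Ne,
          HahnSeries.orderTop_eq_top, sub_eq_zero]
        exact hj
      · push Not at hex
        exfalso
        apply hab
        apply Subtype.ext
        have hgens : ∀ j, a.1 (gens j) = b.1 (gens j) := fun j => by
          have h := hex j
          simp only [g, map_sub, AlgHom.commutes, sub_left_inj] at h
          exact h
        have hcomp : a.1.comp Φ = b.1.comp Φ :=
          MvPolynomial.algHom_ext fun i => by
            change a.1 (Φ (X i)) = b.1 (Φ (X i))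
            rw [hΦX]
            exact hgens i
        refine AlgHom.ext fun z => ?_
        obtain ⟨P, rfl⟩ := hΦ z
        exact DFunLike.congr_fun hcomp P
    · intro a w _ hw
      refine ⟨a, ?_⟩
      have hle : Submodule.span (HahnSeries ℚ k) ((fun u : Fin 3 → k => fun i => HahnSeries.C (u i)) ''
          ((⊥ : Submodule k (Fin 3 → k)) : Set (Fin 3 → k))) ≤ ⊥ := by
        refine Submodule.span_le.mpr ?_
        rintro _ ⟨u, hu, rfl⟩
        have hu0 : u = 0 := hu
        subst hu0
        change (fun i => HahnSeries.C ((0 : Fin 3 → k) i)) ∈ (⊥ : Submodule (HahnSeries ℚ k) _)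
        rw [Submodule.mem_bot]
        funext i
        simp
      have hw0 : w = 0 := (Submodule.mem_bot _).mp (hle hw)
      rw [hw0, add_zero])
  -- … but `B` is not finitely generated
  refine rtdLocalNeg_not_fg_of_support S' hS' (Subalgebra.fg_of_fg_map S' ι hι ?_)
  exact ⟨(Set.range fun i => (g₂ i : K)).toFinset, by rw [Set.coe_toFinset]; exact hgen₂⟩

end FG

/-! ## (a) Load-bearing hypotheses -/

/-- `RisoStrata.RtdLocal` with the hypothesis `hs : s ∈ B` deleted (all other text verbatim). -/
def RtdLocalWithoutMem : Prop :=
  ∀ p : ℕ, p.Prime → ∀ (k : Type) [Field k] [CharP k p] [IsAlgClosed k] (K : Type) [Field K] [Algebra k K] (B : Subalgebra k K) (s : K), s ≠ 0 → B.FG → let Arc : ∀ (B : Subalgebra k K), Ideal ↥B → Type := fun B m => {α : ↥B →ₐ[k] HahnSeries ℚ k // ∀ b ∈ m, 0 < (α b).orderTop}; let Rtd : ∀ (B : Subalgebra k K), Ideal ↥B → ℕ → Prop := fun B m r => ∃ (n : ℕ) (g : Fin n → ↥B), (∀ i, g i ∈ m) ∧ Algebra.adjoin k (Set.range fun i =>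 (g i : K)) = B ∧ ∃ W : Submodule k (Fin n → k), r ≤ Module.finrank k ↥W ∧ ∃ φ : Arc B m → (Fin n → HahnSeries ℚ k), (∀ a b : Arc B m, a ≠ b → ∃ j, ∀ i, (a.1 (g j) - b.1 (g j)).orderTop < ((φ a i - φ b i) - (a.1 (g i) - b.1 (g i))).orderTop) ∧ (∀ a i, 0 < (φ a i).orderTop) ∧ (∀ a, ∀ w : Fin n → HahnSeries ℚ k, (∀ i, 0 < (w i).orderTop) → w ∈ Submodule.span (HahnSeries ℚ k) ((fun u : Fin n → k => fun i => HahnSeries.C (u i)) '' (W : Set (Fin n → k))) → ∃ b, φ b = φ a + w); ∀ (m' : Ideal ↥(Algebra.adjoin k ((B : Set K) ∪ {s⁻¹}))), m'.IsMaximal → ∀ r : ℕ, (Rtd (Algebra.adjoin k ((B : Set K) ∪ {s⁻¹})) m' r ↔ Rtd B (m'.comap (Subalgebra.inclusion (show B ≤ Algebra.adjoin k ((B : Set K) ∪ {s⁻¹}) from fun _ hb => Algebra.subset_adjoin (Set.mem_union_left _ hb)))) r)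

/-- **`s ∈ B` is load-bearing**: `¬ RtdLocalWithoutMem` (the inline theorem, repackaged). -/
theorem rtdLocal_false_without_mem : ¬ RtdLocalWithoutMem :=
  rtdLocal_false_without_mem_inline

/-- `RisoStrata.RtdLocal` with the hypothesis `B.FG` deleted (all other text verbatim). -/
def RtdLocalWithoutFG : Prop :=
  ∀ p : ℕ, p.Prime → ∀ (k : Type) [Field k] [CharP k p] [IsAlgClosed k] (K : Type) [Field K] [Algebra k K] (B : Subalgebra k K) (s : K) (hs : s ∈ B), s ≠ 0 → let Arc : ∀ (B : Subalgebra k K), Ideal ↥B → Type := fun B m => {α : ↥B →ₐ[k] HahnSeries ℚ k // ∀ b ∈ m, 0 < (α b).orderTop}; let Rtd : ∀ (B : Subalgebra k K), Ideal ↥B → ℕ → Prop := fun B m r => ∃ (n : ℕ) (g : Fin n → ↥B), (∀ i, g i ∈ m) ∧ Algebra.adjoin k (Set.range fun i => (g i : K)) = B ∧ ∃ W : Submodule k (Fin n → k), r ≤ Module.finrank k ↥W ∧ ∃ φ : Arc B m → (Fin n → HahnSeries ℚ k), (∀ a b : Arc B m, a ≠ b → ∃ j, ∀ i, (a.1 (g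 j) - b.1 (g j)).orderTop < ((φ a i - φ b i) - (a.1 (g i) - b.1 (g i))).orderTop) ∧ (∀ a i, 0 < (φ a i).orderTop) ∧ (∀ a, ∀ w : Fin n → HahnSeries ℚ k, (∀ i, 0 < (w i).orderTop) → w ∈ Submodule.span (HahnSeries ℚ k) ((fun u : Fin n → k => fun i => HahnSeries.C (u i)) '' (W : Set (Fin n → k))) → ∃ b, φ b = φ a + w); ∀ (m' : Ideal ↥(Algebra.adjoin k ((B : Set K) ∪ {s⁻¹}))), m'.IsMaximal → ∀ r : ℕ, (Rtd (Algebra.adjoin k ((B : Set K) ∪ {s⁻¹})) m' r ↔ Rtd B (m'.comap (Subalgebra.inclusion (show B ≤ Algebra.adjoin k ((B : Set K) ∪ {s⁻¹}) from fun _ hb => Algebra.subset_adjoin (Set.mem_union_left _ hb)))) r)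

/-- **`B.FG` is load-bearing**: `¬ RtdLocalWithoutFG` (the inline theorem below, repackaged;
LANDED copy: `Theorems/RtdLocal/Negative/RtdLocalFalseWithoutFG.lean`, p145103). -/
theorem rtdLocal_false_without_FG : ¬ RtdLocalWithoutFG :=
  rtdLocal_false_without_FG_inline

/-! ## (b)/(c) Boundary facts about the typed `Rtd` -/

/-- `Rtd ⊥ m (r+1)` is false for every proper ideal `m` of `⊥ = k ⊆ K` (any field `k`, any `K`):
the arc space of `⊥` is one point, so clause (3) fails for the translation `w = t·u`, `u ∈ W ∖ 0`.
Stated with the route's clauses (1)–(3) inlined for `B = ⊥`. [folklore] -/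
theorem rtd_bot_succ_false {k : Type} [Field k] {K : Type} [Field K] [Algebra k K]
    (m : Ideal ↥(⊥ : Subalgebra k K)) (hm : m ≠ ⊤) (r : ℕ) :
    ¬ (∃ (n : ℕ) (g : Fin n → ↥(⊥ : Subalgebra k K)), (∀ i, g i ∈ m) ∧
      Algebra.adjoin k (Set.range fun i => (g i : K)) = ⊥ ∧
      ∃ W : Submodule k (Fin n → k), r + 1 ≤ Module.finrank k ↥W ∧
      ∃ φ : {α : ↥(⊥ : Subalgebra k K) →ₐ[k] HahnSeries ℚ k // ∀ b ∈ m, 0 < (α b).orderTop} →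
          (Fin n → HahnSeries ℚ k),
        (∀ a b : {α : ↥(⊥ : Subalgebra k K) →ₐ[k] HahnSeries ℚ k // ∀ b ∈ m, 0 < (α b).orderTop},
          a ≠ b → ∃ j, ∀ i, (a.1 (g j) - b.1 (g j)).orderTop <
            ((φ a i - φ b i) - (a.1 (g i) - b.1 (g i))).orderTop) ∧
        (∀ a i, 0 < (φ a i).orderTop) ∧
        (∀ a, ∀ w : Fin n → HahnSeries ℚ k, (∀ i, 0 < (w i).orderTop) →
          w ∈ Submodule.span (HahnSeries ℚ k)
            ((fun u : Fin n → k => fun i => HahnSeries.C (u i)) '' (W : Set (Fin n → k))) →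
          ∃ b, φ b = φ a + w)) := by
  rintro ⟨n, g, -, -, W, hW, φ, -, -, h3⟩
  let α₀ : ↥(⊥ : Subalgebra k K) →ₐ[k] HahnSeries ℚ k :=
    (Algebra.ofId k (HahnSeries ℚ k)).comp (Algebra.botEquiv k K : _ →ₐ[k] k)
  obtain ⟨u, hu0⟩ :=
    Module.finrank_pos_iff_exists_ne_zero.mp (by omega : 0 < Module.finrank k ↥W)
  obtain ⟨b, hb⟩ := h3 ⟨α₀, rtdLocalNeg_orderTop_pos_of_mem_bot α₀ m hm⟩
    (fun i => HahnSeries.single (1 : ℚ) ((u : Fin n → k) i))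
    (fun i => by
      by_cases hi : (u : Fin n → k) i = 0
      · rw [hi, HahnSeries.single_eq_zero, HahnSeries.orderTop_zero]
        exact WithTop.top_pos
      · rw [HahnSeries.orderTop_single hi]
        exact_mod_cast one_pos)
    (by
      have hw : (fun i => HahnSeries.single (1 : ℚ) ((u : Fin n → k) i)) =
          HahnSeries.single (1 : ℚ) (1 : k) • fun i => HahnSeries.C ((u : Fin n → k) i) := by
        funext i
        rw [Pi.smul_apply, smul_eq_mul, HahnSeries.C_apply, HahnSeries.single_mul_single,
          add_zero, one_mul]
      rw [hw]
      exact Submodule.smul_mem _ _ (Submodule.subset_span ⟨u, u.2, rfl⟩))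
  rw [rtdLocalNeg_arc_bot_subsingleton _ b ⟨α₀, rtdLocalNeg_orderTop_pos_of_mem_bot α₀ m hm⟩]
    at hb
  have hw0 := left_eq_add.mp hb
  apply hu0
  rw [← Submodule.coe_eq_zero]
  funext i
  exact HahnSeries.single_eq_zero_iff.mp (congr_fun hw0 i)

/-! ## Targets
(none registered yet — payload.targets / stuck_stubs were empty when this seat was armed) -/

end Summit.ResolutionOfSingularities.ResolutionOfSingularities.Cruxes.RtdLocal.Disproof
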